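import Literature.Geometry.Kaehler.ComplexTorusGeneralizedHodgeTypeInequality
import Literature.Analysis.Convex.MaclaurinChain
import HarnessLib

/-!
# `k ↦ ((L₀^{g-k} · L^k) / (L₀^g))^{1/k}` is non-increasing for two polarisations of an abelian variety

Layer `Literature/Geometry/Kaehler`, namespace `Literature.Geometry.Kaehler.ComplexTorus`; lane `lit-hodgefound`
(Track 2 foundations library), seat p16, generation 16 (row g16-#6, FILE 2 of 2; FILE 1 =
`Literature/Analysis/Convex/MaclaurinChain.lean`). Sequel of `ComplexTorusGeneralizedHodgeTypeInequality.lean`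
(row g16-#4: `(L₀^{g-ν} · L^ν) = d₀ (g-ν)! ν! e_ν(λ)` for the eigenvalues `λⱼ` of `φ_{L₀}⁻¹ φ_L`) and of
`ComplexTorusMixedDegreeLogConcave.lean` (row g16-#5, not imported). Theorems only (no definition, no named fact;
net debt 0).

## Sources

* R. Lazarsfeld, *Positivity in Algebraic Geometry I* (2004) [Lazarsfeld2004PositivityI], §1.6.A Thm 1.6.1
  (generalized inequality of Hodge type) — the chain of inequalities between the mixed degrees of nef classes that
  §1.6.A draws from it; CITED BY NUMBER (text not held, acq-10410; NOT print-checked). What is proved is the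
  abelian-variety statement below, by a different road.
* H. Lange, *Abelian Varieties over the Complex Numbers* (2023) [Lange2023AbelianVarietiesComplex], §2.4.2
  Prop. 2.4.13 and p. 119 (through g16-#4's `IsRiemannForm.exists_eigenvalues_mixedDegree`).
* D. S. Bernstein, *Matrix Mathematics* (2009) [Bernstein2009], §1.17 Fact 1.17.24 (Maclaurin's chain
  `S_{k'}^{1/k'} ≤ S_k^{1/k}`, held chunk p0108), in the tree as FILE 1 (`Literature.Analysis.Convex.symmMean_pow_succ_le_pow`).

## Statement and proof

For two polarisations `L₀`, `L` of `X = E/ΦΛ` (`η₀`, `η` Riemann forms) and `I_k := (L₀^{g-k} · L^k) =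
∫_X c₁(L₀)^{∧(g-k)} ∧ c₁(L)^{∧k}` (real parts of the tree's `ℂ`-valued integrals): `I_k = d₀ · g! · S_k(λ)` with
`S_k` the `k`th elementary symmetric mean of the POSITIVE eigenvalues `λⱼ = H(wⱼ, wⱼ)` of `φ_{L₀}⁻¹ φ_L` (g16-#4),
so Maclaurin's `S_{k+1}^k ≤ S_k^{k+1}` reads

  `(L₀^g) · (L₀^{g-k-1} · L^{k+1})^k ≤ (L₀^{g-k} · L^k)^{k+1}`   (`1 ≤ k ≤ g - 1`),

i.e. `k ↦ (I_k / I_0)^{1/k}` is non-increasing; `k = g - 1` is the Hodge-type inequality of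
`ComplexTorusHodgeTypeInequality.lean` with the roles of `L₀` and `L` exchanged.

## Contents

* **`IsRiemannForm.mixedDegree_mul_pow_le_pow_succ`** — `I_0 · I_{k+1}^k ≤ I_k^{k+1}`.
* `IsRiemannForm.mixedDegree_div_rpow_antitone` — `(I_{k'}/I_0)^{1/k'} ≤ (I_k/I_0)^{1/k}` for `1 ≤ k ≤ k' ≤ g`;
  `IsRiemannForm.mixedDegree_div_rpow_succ_le` — the consecutive case.
-/

noncomputable section

open Module Function Complex Matrix Finset Polynomial

namespace Literature.Geometry.Kaehler

namespace ComplexTorus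

section Torus

variable {ι : Type*} [Fintype ι] [DecidableEq ι] {E : Type*} [NormedAddCommGroup E] [NormedSpace ℂ E]
  {Φ : (ι → ℝ) ≃L[ℝ] E} {η₀ η : E [⋀^Fin 2]→L[ℝ] ℝ}

variable [FiniteDimensional ℂ E]

/-- `(g-j)! · j! · C(g,j) = g!` in `ℝ` (`j ≤ g`). [folklore] -/
private theorem factorial_mul_factorial_mul_choose' {g j : ℕ} (hj : j ≤ g) :
    ((g - j).factorial : ℝ) * (j.factorial : ℝ) * (g.choose j : ℝ) = g.factorial := by
  have h := Nat.choose_mul_factorial_mul_factorial hj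
  have h' : ((g.choose j * j.factorial * (g - j).factorial : ℕ) : ℝ) = (g.factorial : ℝ) := by rw [h]
  push_cast at h'
  linarith [h']

/-- **`(L₀^g) · (L₀^{g-k-1} · L^{k+1})^k ≤ (L₀^{g-k} · L^k)^{k+1}`** for two polarisations `L₀ = L(H₀, χ₀)`,
`L = L(H, χ)` of the complex torus `X = E/ΦΛ` (`η₀ = Im H₀`, `η = Im H` Riemann forms; `c₁ = -η`; `1 ≤ k ≤ g - 1`;
mixed degrees as real parts of the tree's `ℂ`-valued integrals) — Maclaurin's `S_{k+1}^k ≤ S_k^{k+1}` for the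
positive eigenvalues of `φ_{L₀}⁻¹ φ_L`, since `(L₀^{g-k} · L^k) = d₀ · g! · S_k(λ)`.
[cite: Lazarsfeld2004PositivityI, §1.6.A Thm 1.6.1 (abelian varieties; cited by number)]
[cite: Lange2023AbelianVarietiesComplex, §2.4.2 Prop. 2.4.13] [cite: Bernstein2009, §1.17 Fact 1.17.24] -/
theorem IsRiemannForm.mixedDegree_mul_pow_le_pow_succ (h₀ : IsRiemannForm Φ η₀) (h : IsRiemannForm Φ η)
    {g : ℕ} (e : Fin (2 * g) ≃ ι) {k : ℕ} (hk : 1 ≤ k) (hkg : k + 1 ≤ g) :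
    (torusIntegral Φ e (wedgePow (ofRealForm (-η₀)) g)).re *
        (torusIntegral Φ e (wedgeFamily g (mixedFamily (ofRealForm (-η₀)) (ofRealForm (-η)) g (g - (k + 1))))).re ^ k ≤
      (torusIntegral Φ e (wedgeFamily g (mixedFamily (ofRealForm (-η₀)) (ofRealForm (-η)) g (g - k)))).re ^ (k + 1) := by
  obtain ⟨d₀, c, hd₀, hI, -, hposc, -⟩ := h₀.exists_eigenvalues_mixedDegree (mem_neronSeveriQ_of_isRiemannForm Φ h) e
  have hc : ∀ j, 0 < c j := hposc h.2.2
  have hI0 := hI 0 (Nat.zero_le g)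
  rw [Nat.sub_zero, mixedFamily_self, Finset.powersetCard_zero, sum_singleton, prod_empty, mul_one,
    Nat.factorial_zero, Nat.cast_one, mul_one] at hI0
  rw [show wedgePow (ofRealForm (-η₀)) g = wedgeFamily g (fun _ => ofRealForm (-η₀)) from rfl, hI0,
    hI (k + 1) hkg, hI k (by omega), Complex.ofReal_re, Complex.ofReal_re, Complex.ofReal_re]
  -- Maclaurin for the eigenvalues
  have hM := Literature.Analysis.Convex.symmMean_pow_succ_le_pow c hc hk hkg
  set a := ∑ T ∈ (univ : Finset (Fin g)).powersetCard k, ∏ j ∈ T, c j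
  set b := ∑ T ∈ (univ : Finset (Fin g)).powersetCard (k + 1), ∏ j ∈ T, c j
  have hCk : (0 : ℝ) < (g.choose k : ℝ) := by exact_mod_cast Nat.choose_pos (by omega)
  have hCk1 : (0 : ℝ) < (g.choose (k + 1) : ℝ) := by exact_mod_cast Nat.choose_pos hkg
  -- `d₀ (g-j)! j! e_j = (d₀ g!) · (e_j / C(g,j))`
  have ek : d₀ * ((g - k).factorial : ℝ) * (k.factorial : ℝ) * a = (d₀ * g.factorial) * (a / (g.choose k : ℝ)) := by
    rw [← factorial_mul_factorial_mul_choose' (show k ≤ g by omega)]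
    field_simp
  have ek1 : d₀ * ((g - (k + 1)).factorial : ℝ) * ((k + 1).factorial : ℝ) * b =
      (d₀ * g.factorial) * (b / (g.choose (k + 1) : ℝ)) := by
    rw [← factorial_mul_factorial_mul_choose' hkg]
    field_simp
  rw [ek, ek1]
  calc d₀ * (g.factorial : ℝ) * ((d₀ * g.factorial) * (b / (g.choose (k + 1) : ℝ))) ^ k
      = (d₀ * g.factorial) ^ (k + 1) * (b / (g.choose (k + 1) : ℝ)) ^ k := by ring
    _ ≤ (d₀ * g.factorial) ^ (k + 1) * (a / (g.choose k : ℝ)) ^ (k + 1) :=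
        mul_le_mul_of_nonneg_left hM (by positivity)
    _ = ((d₀ * g.factorial) * (a / (g.choose k : ℝ))) ^ (k + 1) := by ring

/-- **`k ↦ ((L₀^{g-k} · L^k)/(L₀^g))^{1/k}` is non-increasing** (Maclaurin's chain for the positive
eigenvalues of `φ_{L₀}⁻¹ φ_L`): for two polarisations and `1 ≤ k ≤ k' ≤ g`,
`((L₀^{g-k'} · L^{k'})/(L₀^g))^{1/k'} ≤ ((L₀^{g-k} · L^k)/(L₀^g))^{1/k}`. At `k = 1`, `k' = g` this is
`((L^g)/(L₀^g))^{1/g} ≤ (L₀^{g-1} · L)/(L₀^g)`, the Hodge-type inequality of `ComplexTorusHodgeTypeInequality.lean`.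
[cite: Lazarsfeld2004PositivityI, §1.6.A Thm 1.6.1 (abelian varieties; cited by number)]
[cite: Bernstein2009, §1.17 Fact 1.17.24 (middle inequality)] -/
theorem IsRiemannForm.mixedDegree_div_rpow_antitone (h₀ : IsRiemannForm Φ η₀) (h : IsRiemannForm Φ η)
    {g : ℕ} (e : Fin (2 * g) ≃ ι) {k k' : ℕ} (hk : 1 ≤ k) (hkk' : k ≤ k') (hk'g : k' ≤ g) :
    ((torusIntegral Φ e (wedgeFamily g (mixedFamily (ofRealForm (-η₀)) (ofRealForm (-η)) g (g - k')))).re /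
          (torusIntegral Φ e (wedgePow (ofRealForm (-η₀)) g)).re) ^ ((1 : ℝ) / k') ≤
      ((torusIntegral Φ e (wedgeFamily g (mixedFamily (ofRealForm (-η₀)) (ofRealForm (-η)) g (g - k)))).re /
          (torusIntegral Φ e (wedgePow (ofRealForm (-η₀)) g)).re) ^ ((1 : ℝ) / k) := by
  obtain ⟨d₀, c, hd₀, hI, -, hposc, -⟩ := h₀.exists_eigenvalues_mixedDegree (mem_neronSeveriQ_of_isRiemannForm Φ h) e
  have hc : ∀ j, 0 < c j := hposc h.2.2
  have hI0 := hI 0 (Nat.zero_le g)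
  rw [Nat.sub_zero, mixedFamily_self, Finset.powersetCard_zero, sum_singleton, prod_empty, mul_one,
    Nat.factorial_zero, Nat.cast_one, mul_one] at hI0
  rw [show wedgePow (ofRealForm (-η₀)) g = wedgeFamily g (fun _ => ofRealForm (-η₀)) from rfl, hI0,
    hI k' hk'g, hI k (hkk'.trans hk'g), Complex.ofReal_re, Complex.ofReal_re, Complex.ofReal_re]
  have hM := Literature.Analysis.Convex.symmMean_rpow_antitone c hc hk hkk' hk'g
  -- `d₀ (g-j)! j! e_j / (d₀ g!) = e_j / C(g,j) = S_j`
  have eS : ∀ {j : ℕ}, j ≤ g →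
      d₀ * ((g - j).factorial : ℝ) * (j.factorial : ℝ) *
          (∑ T ∈ (univ : Finset (Fin g)).powersetCard j, ∏ i ∈ T, c i) / (d₀ * g.factorial) =
        (∑ T ∈ (univ : Finset (Fin g)).powersetCard j, ∏ i ∈ T, c i) / (g.choose j : ℝ) := fun {j} hj => by
    rw [← factorial_mul_factorial_mul_choose' hj]
    have hCj : (0 : ℝ) < (g.choose j : ℝ) := by exact_mod_cast Nat.choose_pos hj
    field_simp
  rw [eS hk'g, eS (hkk'.trans hk'g)]
  exact hM

/-- The consecutive case: `((L₀^{g-k-1} · L^{k+1})/(L₀^g))^{1/(k+1)} ≤ ((L₀^{g-k} · L^k)/(L₀^g))^{1/k}` for two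
polarisations and `1 ≤ k ≤ g - 1`. [cite: Lazarsfeld2004PositivityI, §1.6.A Thm 1.6.1 (abelian varieties; cited by number)]
[cite: Bernstein2009, §1.17 Fact 1.17.24 (middle inequality)] -/
theorem IsRiemannForm.mixedDegree_div_rpow_succ_le (h₀ : IsRiemannForm Φ η₀) (h : IsRiemannForm Φ η)
    {g : ℕ} (e : Fin (2 * g) ≃ ι) {k : ℕ} (hk : 1 ≤ k) (hkg : k + 1 ≤ g) :
    ((torusIntegral Φ e (wedgeFamily g (mixedFamily (ofRealForm (-η₀)) (ofRealForm (-η)) g (g - (k + 1))))).re /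
          (torusIntegral Φ e (wedgePow (ofRealForm (-η₀)) g)).re) ^ ((1 : ℝ) / (k + 1 : ℕ)) ≤
      ((torusIntegral Φ e (wedgeFamily g (mixedFamily (ofRealForm (-η₀)) (ofRealForm (-η)) g (g - k)))).re /
          (torusIntegral Φ e (wedgePow (ofRealForm (-η₀)) g)).re) ^ ((1 : ℝ) / k) :=
  h₀.mixedDegree_div_rpow_antitone h e hk (Nat.le_succ k) hkg

end Torus

end ComplexTorus

end Literature.Geometry.Kaehler

end
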